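import Summits.Ventures.HodgeRepro2.T5CMCompletionBaseChange
import Summits.Ventures.HodgeRepro2.T5GramBaseChange
import Summits.Ventures.HodgeRepro2.T5CMSymplectic

/-!
# Tier-5 support (seat p3, cell pub-hodge-repro2) — the CM conjugation on the completion at an
archimedean place: `c ⊗ 1` on `K⁺_v ⊗[K⁺] K = K_w` is the complex conjugation of `K_w ≅ ℂ`

Behind route/T4-B1-p3.md v7 (sub-claim B1, FINAL) l. 32 «(Liu's «(induced) involution c on
A_E»); at a place v it is c ⊗ 1 on F_v = F ⊗_{F⁺} F⁺_v, complex conjugation at the real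
places» and l. 33 «… with c ↦ complex conjugation», at the archimedean places, in Mathlib's
completion vocabulary (continuing file 106, `T5CMCompletionBaseChange`): for `IsCMField K`, an
infinite place `v` of `K⁺` and `w` of `K` over it,

* `conjCompletion K w : w.Completion ≃+* w.Completion` is the complex conjugation transported
  from `ℂ` through `w.Completion ≃+* ℂ` (file 105's `complexCompletionEquiv`);
* it extends the CM conjugation of `K` (`conjCompletion_algebraMap`: `c` on `K ⊂ K_w`), it is
  an involution, and it is `v.Completion`-linear (`conjCompletion_smul`: `K⁺_v = ℝ` is fixed —
  Mathlib's `liesOver_extensionEmbedding_apply` + `extensionEmbeddingOfIsReal_apply`);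
* under file 106's identification `K⁺_v ⊗[K⁺] K ≃ₐ[K⁺_v] K_w`, the base-changed conjugation
  `1 ⊗ c` — file 101's `T5GramBaseChange.conjTensor v.Completion _` (`a ⊗ x ↦ a ⊗ star x`,
  `star = complexConj K`), not re-declared — IS `conjCompletion K w`
  (`completionBaseChangeEquiv_conjTensor`) — B1's «c ⊗ 1 on F_v … complex conjugation at the
  real places».

Nothing here is a display; Mathlib + own files 96 / 101 / 102 / 105 / 106. Header declaration
(README §8(d)): uses an L-value-free non-vanishing device: NO.
-/

open NumberField NumberField.InfinitePlace NumberField.InfinitePlace.Completion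
open scoped NumberField.LiesOver TensorProduct ComplexConjugate

namespace Summit.Ventures.HodgeRepro2.T5CMCompletionConj

open T5CMInfinitePlaces T5CMCompletionBaseChange

variable (K : Type*) [Field K] [NumberField K] [IsCMField K]

/-! ## 1. The conjugation of `K_w`, transported from `ℂ` -/

/-- The complex conjugation of `w.Completion`, transported from `ℂ` through
`w.Completion ≃+* ℂ`. -/
noncomputable def conjCompletion (w : InfinitePlace K) : w.Completion ≃+* w.Completion :=
  (complexCompletionEquiv K w).trans
    (Complex.conjAe.toRingEquiv.trans (complexCompletionEquiv K w).symm)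

/-- `complexCompletionEquiv K w (conjCompletion K w y) = conj (complexCompletionEquiv K w y)`. -/
theorem complexCompletionEquiv_conjCompletion (w : InfinitePlace K) (y : w.Completion) :
    complexCompletionEquiv K w (conjCompletion K w y) = conj (complexCompletionEquiv K w y) := by
  simp [conjCompletion]

/-- `conjCompletion` is an involution. -/
theorem conjCompletion_conjCompletion (w : InfinitePlace K) (y : w.Completion) :
    conjCompletion K w (conjCompletion K w y) = y := by
  apply (complexCompletionEquiv K w).injective
  rw [complexCompletionEquiv_conjCompletion, complexCompletionEquiv_conjCompletion,
    Complex.conj_conj]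

omit [NumberField K] [IsCMField K] in
/-- `extensionEmbedding w (x : w.Completion) = w.embedding x` for `x ∈ K`. -/
theorem extensionEmbedding_algebraMap (w : InfinitePlace K) (x : K) :
    extensionEmbedding w (algebraMap K w.Completion x) = w.embedding x :=
  extensionEmbedding_coe w (WithAbs.toAbs w.1 x)

/-- `conjCompletion` extends the CM conjugation of `K`: `conjCompletion (x : K_w) = (c x : K_w)`
(Mathlib's `complexEmbedding_complexConj`). -/
theorem conjCompletion_algebraMap (w : InfinitePlace K) (x : K) :
    conjCompletion K w (algebraMap K w.Completion x) =
      algebraMap K w.Completion (IsCMField.complexConj K x) := by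
  apply (complexCompletionEquiv K w).injective
  rw [complexCompletionEquiv_conjCompletion]
  simp only [complexCompletionEquiv, ringEquivComplexOfIsComplex_apply,
    extensionEmbedding_algebraMap, IsCMField.complexEmbedding_complexConj]

/-! ## 2. `v.Completion`-linearity: the real completion is fixed -/

variable (v : InfinitePlace (maximalRealSubfield K)) (w : InfinitePlace K) [w.1.LiesOver v.1]

omit [IsCMField K] in
/-- `extensionEmbedding w` restricted to `v.Completion` is `extensionEmbedding v`, real-valued. -/
theorem extensionEmbedding_algebraMap_completion (c : v.Completion) :
    extensionEmbedding w (algebraMap v.Completion w.Completion c) = extensionEmbedding v c := by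
  haveI := LiesOver.extensionEmbedding_liesOver_of_isReal w (isReal K v)
  exact liesOver_extensionEmbedding_apply w v

omit [IsCMField K] in
/-- `extensionEmbedding v c` is a real number: `conj` fixes it. -/
theorem conj_extensionEmbedding_real (c : v.Completion) :
    conj (extensionEmbedding v c) = extensionEmbedding v c := by
  rw [← extensionEmbeddingOfIsReal_apply (isReal K v) c, Complex.conj_ofReal]

/-- `conjCompletion` is `v.Completion`-linear: `conjCompletion (c • y) = c • conjCompletion y`. -/
theorem conjCompletion_smul (c : v.Completion) (y : w.Completion) :
    conjCompletion K w (c • y) = c • conjCompletion K w y := by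
  apply (complexCompletionEquiv K w).injective
  rw [complexCompletionEquiv_conjCompletion, Algebra.smul_def, Algebra.smul_def, map_mul,
    map_mul, map_mul, complexCompletionEquiv_conjCompletion]
  simp only [complexCompletionEquiv, ringEquivComplexOfIsComplex_apply,
    extensionEmbedding_algebraMap_completion, conj_extensionEmbedding_real]

/-! ## 3. Under the base-change identification, `1 ⊗ c` (file 101's `conjTensor`) is
`conjCompletion` -/

/-- B1 l. 32 at the archimedean places: under `K⁺_v ⊗[K⁺] K ≃ K_w` (file 106), the base-changed
conjugation `1 ⊗ c` is the complex conjugation of `K_w`. -/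
theorem completionBaseChangeHom_conjTensor (y : v.Completion ⊗[maximalRealSubfield K] K) :
    completionBaseChangeHom K v w
        (T5GramBaseChange.conjTensor v.Completion (T5CMSymplectic.star_algebraMap K) y) =
      conjCompletion K w (completionBaseChangeHom K v w y) := by
  induction y using TensorProduct.induction_on with
  | zero => simp
  | tmul c x =>
    rw [T5GramBaseChange.conjTensor_tmul, completionBaseChangeHom_tmul,
      completionBaseChangeHom_tmul, conjCompletion_smul, conjCompletion_algebraMap]
    rfl
  | add y z hy hz => simp only [map_add, hy, hz]

/-- The same for the isomorphism `completionBaseChangeEquiv K v w`. -/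
theorem completionBaseChangeEquiv_conjTensor (y : v.Completion ⊗[maximalRealSubfield K] K) :
    completionBaseChangeEquiv K v w
        (T5GramBaseChange.conjTensor v.Completion (T5CMSymplectic.star_algebraMap K) y) =
      conjCompletion K w (completionBaseChangeEquiv K v w y) :=
  completionBaseChangeHom_conjTensor K v w y

end Summit.Ventures.HodgeRepro2.T5CMCompletionConj
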